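import Summits.QuantumFields.BalabanUV.Beta.D1BFx.PackedWordPairing
import Summits.QuantumFields.BalabanUV.Beta.ChartConjugationReflection
import Summits.QuantumFields.BalabanUV.Beta.D1BFx.GhostAveragingSquare

/-!
# `BalabanUV.Beta.D1BFx.PackedWordSplit` — road «BF-x» for binder row D1, slot (K), junction (J3), TB5-1′ ROUTE M's expansion, GENERIC CORE:
# **THE PACKED ONE-LOOP WORD OF A SPLIT TRIPLE** — for a spread leg `A`, localised stencil families `S₁, S₂`, localised tables `W₁, W₂` and ANY
# decaying weight family `w` (the road's `colH K₀` or `colH G₀`), the `hessKer` word of the packed SUMS `(S₁ + S₂, W₁ + W₂)` equals the word of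
# `(S₁, W₁)` plus FOUR words each carrying a «second» factor: `½·tadpole(𝒲[w;W₂]) − ½·(bubble(𝒱[w;S₁],𝒱[w;S₂]) + bubble(𝒱[w;S₂],𝒱[w;S₁]) + bubble(𝒱[w;S₂],𝒱[w;S₂]))`
# (`𝒱[w;S] μ y := Σ_κ wsum (w μ y κ) (S κ)`, `𝒲[w;W] μ y ν y′ := Σ_κ Σ_l wsum (w μ y κ) (u ↦ wsum (w ν y′ l) (W κ u l))` written INLINE).
# At the ghost data (`S₁ = cK•ghCur`, `S₂ = cQ•qAntiAt`, `W₁ = diagExt ((x₀cK)•ghX)`, `W₂ = (−x₀cQn⁴)•qSqAt`: `GhostStencilRooted.SghAt_apply`,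
# `GhostAveragingSquare.WghAt_eq`) and the road's weights this is the located decomposition of `RJ3` in TB5-1′ §3 (ROUTE M): with `GhostWardWord`
# («dressed completed word = undressed = PghQ»), «dressed `D*D`-only word − PghQ = −(four dressed `Q′`-words)».  The instance is the OWNER's ∕ a sequel's.

HONEST DEPENDENCY (cell records, verbatim): «continuum YM on T⁴ ⇐ BetaPertH ∧ nine spine estimates (0/9 proved); BetaPertH ⇐ (D1) ∧ (D4) ∧
CAP+tail; G-an2-4 gates asym, D1 and NE2/3/4.»  HONEST FRAMING (cell contract, verbatim): «discharging `BetaPertH` makes Bałaban's UV stability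
UNCONDITIONAL — a real constructive-QFT result; it is NOT the continuum limit and NOT the Clay problem.»  THIS MODULE DISCHARGES NOTHING of the
wall: [folklore] linearity BY NAME (`ChartConjugationReflection.wsum_add`, `TameKernelCalculus.tadpole_add ∕ bubble_add_left ∕ bubble_add_right ∕ Loc.add`,
`PackedWordPairing.loc_packed_*`); hypotheses only; nothing of Bałaban's asserted; no definition, no `def … : Prop`, no notation, nothing cited,
0 sorry.  0 root-level binders of row D1 discharged (hW ∕ hR-sockets ∕ hSX-socket ∕ D1Tel ∕ D1Rep — 0); (J3) DISPLAYED; (K) NOT closed; NOT D1,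
NOT `BetaPertH`, NOT continuum, NOT Clay.

ABSOLUTE RULE (cell charter, verbatim): «No internally-minted statement may enter as a cited fact. Every hypothesis is either kernel-proved in
this package or a verbatim quotation of a PUBLISHED theorem with page reference. The manuscript(s) under audit are NOT citable for their own
disputed steps — they are the thing under adjudication; programme-internal (2001/route/tribunal) claims are never citable.»

Unit `b2b-balaban-beta-d1-formalise-leaf-04` (gen 21), D1 formalisation swarm leaf prover 04, road «BF-x»; TB5-1′ §3 (OWNER d1-p2 g20 ρ-g20-1, journal).
-/

noncomputable section

open Finset
open scoped BigOperators
open Literature.MathematicalPhysics.QuantumFieldTheory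
open Literature.MathematicalPhysics.QuantumFieldTheory.Balaban1983to89
open Literature.MathematicalPhysics.QuantumFieldTheory.Balaban1983to89.Beta
open B12Sec2to5 (l1 l1_nonneg)
open ExpKernelCalculus (Site MKer BiLoc Zl hessKer bubble tadpole summable_exp_shift')
open OneStepResolventKernel (wsum)
open KernelWard (bdd_of_biLoc)
open Summit.QuantumFields.BalabanUV.Beta.TameKernelCalculus (Spr Loc biLoc_of_le tadpole_add bubble_add_left bubble_add_right)
open Summit.QuantumFields.BalabanUV.Beta.KernelWardRelative (loc_finset_sum)
open Summit.QuantumFields.BalabanUV.Beta.ChartConjugationReflection (wsum_add)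
open Summit.QuantumFields.BalabanUV.Beta.D1BFx.DressedBubbleBridge (expWeight_of_le)
open Summit.QuantumFields.BalabanUV.Beta.D1BFx.DressedTadpoleTable (biLoc_wsum_snd)
open Summit.QuantumFields.BalabanUV.Beta.D1BFx.PackedWordPairing (loc_packed_stencil loc_packed_table)
open Summit.QuantumFields.BalabanUV.Beta.D1BFx.GhostLeg (Ggh spr_Ggh)
open Summit.QuantumFields.BalabanUV.Beta.D1BFx.GhostStencil (ghCur biLoc_ghCur)
open Summit.QuantumFields.BalabanUV.Beta.D1BFx.GhostStencilRooted (qAntiAt SghAt SghAt_apply biLoc_qAntiAt)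
open Summit.QuantumFields.BalabanUV.Beta.D1BFx.GhostStencilReflection (ghX biLoc_ghX)
open Summit.QuantumFields.BalabanUV.Beta.D1BFx.ReducedKernelSandwichBlock (diagExt biLoc_diagExt)
open Summit.QuantumFields.BalabanUV.Beta.D1BFx.GhostKernel (biLoc_smul')
open Summit.QuantumFields.BalabanUV.Beta.D1BFx.GhostAveragingSquare (qSqAt WghAt WghAt_eq biLoc_qSqAt)

namespace Summit.QuantumFields.BalabanUV.Beta.D1BFx.PackedWordSplit

variable {F : Type*} [Fintype F]

omit [Fintype F] in
/-- [folklore] A weight decaying in `ℓ¹` from a centre is absolutely summable. -/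
theorem summable_abs_weight {w : Site 4 → ℝ} {Cw δw : ℝ} {p : Site 4} (hw : ∀ u, |w u| ≤ Cw * Real.exp (-δw * l1 (u - p)))
    (hδw : 0 < δw) : Summable fun u => |w u| :=
  Summable.of_nonneg_of_le (fun _ => abs_nonneg _) hw ((summable_exp_shift' hδw p).mul_left Cw)

section Split

variable {A : MKer 4 F} {S₁ S₂ : Fin 4 → Site 4 → MKer 4 F} {W₁ W₂ : Fin 4 → Site 4 → Fin 4 → Site 4 → MKer 4 F}
  {C₁ C₂ D₁ D₂ δ : ℝ} {w : Fin 4 → Site 4 → Fin 4 → Site 4 → ℝ} {Cw δw : ℝ} {P : Fin 4 → Site 4 → Site 4}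

omit [Fintype F] in
/-- [folklore] **THE STENCIL PACK IS ADDITIVE**: `𝒱[w; S₁ + S₂] = 𝒱[w;S₁] + 𝒱[w;S₂]` (localised, hence bounded, families; `ℓ¹` weights; `wsum_add`). -/
theorem packV_add (hS₁ : ∀ κ u, BiLoc (S₁ κ u) u u C₁ δ) (hS₂ : ∀ κ u, BiLoc (S₂ κ u) u u C₂ δ) (hδ : 0 ≤ δ)
    (hw : ∀ μ y κ u, |w μ y κ u| ≤ Cw * Real.exp (-δw * l1 (u - P μ y))) (hδw : 0 < δw) :
    (fun μ y => ∑ κ : Fin 4, wsum (w μ y κ) (fun u => S₁ κ u + S₂ κ u))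
      = (fun μ y => ∑ κ : Fin 4, wsum (w μ y κ) (S₁ κ)) + fun μ y => ∑ κ : Fin 4, wsum (w μ y κ) (S₂ κ) := by
  funext μ y
  simp only [Pi.add_apply]
  rw [← Finset.sum_add_distrib]
  refine Finset.sum_congr rfl fun κ _ => ?_
  exact wsum_add (summable_abs_weight (hw μ y κ) hδw) (B := |C₁| + |C₂|)
    (fun u x z a b => (bdd_of_biLoc (hS₁ κ u) hδ x z a b).trans ((le_abs_self _).trans (le_add_of_nonneg_right (abs_nonneg _))))
    (fun u x z a b => (bdd_of_biLoc (hS₂ κ u) hδ x z a b).trans ((le_abs_self _).trans (le_add_of_nonneg_left (abs_nonneg _))))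

omit [Fintype F] in
/-- [folklore] **THE TABLE PACK IS ADDITIVE**: `𝒲[w; W₁ + W₂] = 𝒲[w;W₁] + 𝒲[w;W₂]` (inner `wsum_add` on the bounded tables, outer `wsum_add` on the inner
superpositions, which are bi-localised — `DressedTadpoleTable.biLoc_wsum_snd` — hence bounded). -/
theorem packW_add (hW₁ : ∀ κ u l u', BiLoc (W₁ κ u l u') u u' D₁ δ) (hW₂ : ∀ κ u l u', BiLoc (W₂ κ u l u') u u' D₂ δ) (hδ : 0 < δ)
    (hw : ∀ μ y κ u, |w μ y κ u| ≤ Cw * Real.exp (-δw * l1 (u - P μ y))) (hCw : 0 ≤ Cw) (hδw : 0 < δw) :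
    (fun μ y ν y' => ∑ κ : Fin 4, ∑ l : Fin 4, wsum (w μ y κ) (fun u => wsum (w ν y' l) (fun u' => W₁ κ u l u' + W₂ κ u l u')))
      = (fun μ y ν y' => ∑ κ : Fin 4, ∑ l : Fin 4, wsum (w μ y κ) (fun u => wsum (w ν y' l) (W₁ κ u l)))
        + fun μ y ν y' => ∑ κ : Fin 4, ∑ l : Fin 4, wsum (w μ y κ) (fun u => wsum (w ν y' l) (W₂ κ u l)) := by
  funext μ y ν y'
  simp only [Pi.add_apply]
  rw [← Finset.sum_add_distrib]
  refine Finset.sum_congr rfl fun κ _ => ?_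
  rw [← Finset.sum_add_distrib]
  refine Finset.sum_congr rfl fun l _ => ?_
  have hm : 0 < min δw δ := lt_min hδw hδ
  -- inner additivity
  have hin : ∀ u, wsum (w ν y' l) (fun u' => W₁ κ u l u' + W₂ κ u l u') = wsum (w ν y' l) (W₁ κ u l) + wsum (w ν y' l) (W₂ κ u l) :=
    fun u => wsum_add (summable_abs_weight (hw ν y' l) hδw) (B := |D₁| + |D₂|)
      (fun u' x z a b => (bdd_of_biLoc (hW₁ κ u l u') hδ.le x z a b).trans ((le_abs_self _).trans (le_add_of_nonneg_right (abs_nonneg _))))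
      (fun u' x z a b => (bdd_of_biLoc (hW₂ κ u l u') hδ.le x z a b).trans ((le_abs_self _).trans (le_add_of_nonneg_left (abs_nonneg _))))
  simp_rw [hin]
  -- the inner superpositions are bi-localised, hence bounded
  have hX₁ : ∀ u, BiLoc (wsum (w ν y' l) (W₁ κ u l)) u (P ν y') (Cw * |D₁| * Zl 4 (min δw δ / 2)) (min δw δ / 2) := fun u =>
    biLoc_wsum_snd (fun u' => expWeight_of_le (hw ν y' l) hCw (min_le_left _ _) u')
      (fun u' => biLoc_of_le (hW₁ κ u l u') (min_le_right _ _)) hm hCw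
  have hX₂ : ∀ u, BiLoc (wsum (w ν y' l) (W₂ κ u l)) u (P ν y') (Cw * |D₂| * Zl 4 (min δw δ / 2)) (min δw δ / 2) := fun u =>
    biLoc_wsum_snd (fun u' => expWeight_of_le (hw ν y' l) hCw (min_le_left _ _) u')
      (fun u' => biLoc_of_le (hW₂ κ u l u') (min_le_right _ _)) hm hCw
  exact wsum_add (summable_abs_weight (hw μ y κ) hδw) (B := |Cw * |D₁| * Zl 4 (min δw δ / 2)| + |Cw * |D₂| * Zl 4 (min δw δ / 2)|)
    (fun u x z a b => (bdd_of_biLoc (hX₁ u) (half_pos hm).le x z a b).trans ((le_abs_self _).trans (le_add_of_nonneg_right (abs_nonneg _))))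
    (fun u x z a b => (bdd_of_biLoc (hX₂ u) (half_pos hm).le x z a b).trans ((le_abs_self _).trans (le_add_of_nonneg_left (abs_nonneg _))))

/-- [folklore] **THE PACKED WORD OF A SPLIT TRIPLE**: with `J_i := 𝒱[w;S_i]`, `T_i := 𝒲[w;W_i]`,
`hessKer A (𝒱[w;S₁+S₂]) (𝒲[w;W₁+W₂]) μ ν z = hessKer A J₁ T₁ μ ν z + (½·tadpole A (T₂ μ 0 ν z) − ½·(bubble A (J₁ μ 0) (J₂ ν z) + bubble A (J₂ μ 0) (J₁ ν z) + bubble A (J₂ μ 0) (J₂ ν z)))`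
— every extra word carries an `S₂` or a `W₂` factor (§1 additivity + `tadpole_add` ∕ `bubble_add_left ∕ _right` at `PackedWordPairing.loc_packed_*`). -/
theorem word_split (hA : Spr A) (hS₁ : ∀ κ u, BiLoc (S₁ κ u) u u C₁ δ) (hS₂ : ∀ κ u, BiLoc (S₂ κ u) u u C₂ δ)
    (hW₁ : ∀ κ u l u', BiLoc (W₁ κ u l u') u u' D₁ δ) (hW₂ : ∀ κ u l u', BiLoc (W₂ κ u l u') u u' D₂ δ) (hδ : 0 < δ)
    (hw : ∀ μ y κ u, |w μ y κ u| ≤ Cw * Real.exp (-δw * l1 (u - P μ y))) (hCw : 0 ≤ Cw) (hδw : 0 < δw)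
    (μ ν : Fin 4) (z : Site 4) :
    hessKer A (fun μ y => ∑ κ : Fin 4, wsum (w μ y κ) (fun u => S₁ κ u + S₂ κ u))
        (fun μ y ν y' => ∑ κ : Fin 4, ∑ l : Fin 4, wsum (w μ y κ) (fun u => wsum (w ν y' l) (fun u' => W₁ κ u l u' + W₂ κ u l u'))) μ ν z
      = hessKer A (fun μ y => ∑ κ : Fin 4, wsum (w μ y κ) (S₁ κ))
          (fun μ y ν y' => ∑ κ : Fin 4, ∑ l : Fin 4, wsum (w μ y κ) (fun u => wsum (w ν y' l) (W₁ κ u l))) μ ν z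
        + ((1 / 2) * tadpole A (∑ κ : Fin 4, ∑ l : Fin 4, wsum (w μ 0 κ) (fun u => wsum (w ν z l) (W₂ κ u l)))
          - (1 / 2) * (bubble A (∑ κ : Fin 4, wsum (w μ 0 κ) (S₁ κ)) (∑ κ : Fin 4, wsum (w ν z κ) (S₂ κ))
              + bubble A (∑ κ : Fin 4, wsum (w μ 0 κ) (S₂ κ)) (∑ κ : Fin 4, wsum (w ν z κ) (S₁ κ))
              + bubble A (∑ κ : Fin 4, wsum (w μ 0 κ) (S₂ κ)) (∑ κ : Fin 4, wsum (w ν z κ) (S₂ κ)))) := by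
  rw [packV_add hS₁ hS₂ hδ.le hw hδw, packW_add hW₁ hW₂ hδ hw hCw hδw]
  unfold ExpKernelCalculus.hessKer
  simp only [Pi.add_apply]
  have hJ₁ : ∀ (μ : Fin 4) (y : Site 4), Loc (∑ κ : Fin 4, wsum (w μ y κ) (S₁ κ)) :=
    fun μ y => loc_finset_sum _ fun κ => loc_packed_stencil hS₁ hδ hw hCw hδw μ y κ
  have hJ₂ : ∀ (μ : Fin 4) (y : Site 4), Loc (∑ κ : Fin 4, wsum (w μ y κ) (S₂ κ)) :=
    fun μ y => loc_finset_sum _ fun κ => loc_packed_stencil hS₂ hδ hw hCw hδw μ y κ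
  have hT₁ : Loc (∑ κ : Fin 4, ∑ l : Fin 4, wsum (w μ 0 κ) (fun u => wsum (w ν z l) (W₁ κ u l))) :=
    loc_finset_sum _ fun κ => loc_finset_sum _ fun l => loc_packed_table hW₁ hδ hw hCw hδw μ 0 ν z κ l
  have hT₂ : Loc (∑ κ : Fin 4, ∑ l : Fin 4, wsum (w μ 0 κ) (fun u => wsum (w ν z l) (W₂ κ u l))) :=
    loc_finset_sum _ fun κ => loc_finset_sum _ fun l => loc_packed_table hW₂ hδ hw hCw hδw μ 0 ν z κ l
  rw [tadpole_add hA hT₁ hT₂, bubble_add_left hA (hJ₁ μ 0) (hJ₂ μ 0) ((hJ₁ ν z).add (hJ₂ ν z)),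
    bubble_add_right hA (hJ₁ μ 0) (hJ₁ ν z) (hJ₂ ν z), bubble_add_right hA (hJ₂ μ 0) (hJ₁ ν z) (hJ₂ ν z)]
  ring

end Split

/-! ## §2 The ghost instance: the completed data split into its `D*D` part and its `Q′` part, at ANY decaying weight family -/

section Ghost

variable (n : ℕ) [NeZero n] {a : ℝ} (ha : 0 < a) {ρ : Site 4} (hρ : ∀ i : Fin 4, 0 ≤ ρ i ∧ ρ i < n) (x₀ cK cQ : ℝ)
  {w : Fin 4 → Site 4 → Fin 4 → Site 4 → ℝ} {Cw δw : ℝ} {P : Fin 4 → Site 4 → Site 4}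
  (hw : ∀ μ y κ u, |w μ y κ u| ≤ Cw * Real.exp (-δw * l1 (u - P μ y))) (hCw : 0 ≤ Cw) (hδw : 0 < δw)

omit [NeZero n] in
/-- [folklore] The completed stencil as the SUM of its `D*D` part and its `Q′` part, as kernel families: `SghAt ρ n cK cQ = (κ u ↦ cK•ghCur κ u + cQ•qAntiAt ρ n κ u)`. -/
theorem SghAt_eq_add : SghAt ρ n cK cQ = fun κ u => cK • ghCur κ u + cQ • qAntiAt ρ n κ u := by
  funext κ u x z a' b
  simp only [SghAt_apply, Pi.add_apply, Pi.smul_apply, smul_eq_mul]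

omit [NeZero n] in
/-- [folklore] The completed table as the SUM of its `D*D` part and its `Q′` part (`GhostAveragingSquare.WghAt_eq`). -/
theorem WghAt_eq_add : WghAt ρ n x₀ cK cQ
    = fun κ v l v' => diagExt (fun μ y => (x₀ * cK) • ghX μ y) κ v l v' + (fun κ v l v' => (-(x₀ * cQ * (n : ℝ) ^ 4)) • qSqAt ρ n κ v l v') κ v l v' := by
  funext κ v l v'
  exact WghAt_eq ρ n x₀ cK cQ κ v l v'

include ha hρ hw hCw hδw in
/-- [folklore] **THE GHOST WORD SPLIT** (TB5-1′ §3, ROUTE M, located decomposition): at ANY decaying weight family `w` (the road's `colH G₀ (m+1)` or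
`colH K₀ (m+1)`), the packed one-loop word of the COMPLETED ghost data `(Ggh n a, SghAt ρ n cK cQ, WghAt ρ n x₀ cK cQ)` equals the word of its
`D*D` part `(cK•ghCur, diagExt ((x₀cK)•ghX))` PLUS four words each carrying a `Q′` jet (`cQ•qAntiAt` or `(−x₀cQn⁴)•qSqAt`):
`W[S_full,W_full] = W[S_D,W_D] + ½·tadpole(𝒲[w; W_Q]) − ½·(bubble(𝒱S_D,𝒱S_Q) + bubble(𝒱S_Q,𝒱S_D) + bubble(𝒱S_Q,𝒱S_Q))` (§1 at the ghost sockets, rate `1/n`). -/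
theorem ghost_word_split (μ ν : Fin 4) (z : Site 4) :
    hessKer (Ggh n a) (fun μ y => ∑ κ : Fin 4, wsum (w μ y κ) (SghAt ρ n cK cQ κ))
        (fun μ y ν y' => ∑ κ : Fin 4, ∑ l : Fin 4, wsum (w μ y κ) (fun u => wsum (w ν y' l) (WghAt ρ n x₀ cK cQ κ u l))) μ ν z
      = hessKer (Ggh n a) (fun μ y => ∑ κ : Fin 4, wsum (w μ y κ) (fun u => cK • ghCur κ u))
          (fun μ y ν y' => ∑ κ : Fin 4, ∑ l : Fin 4, wsum (w μ y κ)
            (fun u => wsum (w ν y' l) (diagExt (fun μ y => (x₀ * cK) • ghX μ y) κ u l))) μ ν z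
        + ((1 / 2) * tadpole (Ggh n a) (∑ κ : Fin 4, ∑ l : Fin 4, wsum (w μ 0 κ)
              (fun u => wsum (w ν z l) (fun v' => (-(x₀ * cQ * (n : ℝ) ^ 4)) • qSqAt ρ n κ u l v')))
          - (1 / 2) * (bubble (Ggh n a) (∑ κ : Fin 4, wsum (w μ 0 κ) (fun u => cK • ghCur κ u)) (∑ κ : Fin 4, wsum (w ν z κ) (fun u => cQ • qAntiAt ρ n κ u))
              + bubble (Ggh n a) (∑ κ : Fin 4, wsum (w μ 0 κ) (fun u => cQ • qAntiAt ρ n κ u)) (∑ κ : Fin 4, wsum (w ν z κ) (fun u => cK • ghCur κ u))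
              + bubble (Ggh n a) (∑ κ : Fin 4, wsum (w μ 0 κ) (fun u => cQ • qAntiAt ρ n κ u))
                  (∑ κ : Fin 4, wsum (w ν z κ) (fun u => cQ • qAntiAt ρ n κ u)))) := by
  have hn : (0 : ℝ) < 1 / (n : ℝ) := div_pos one_pos (by exact_mod_cast Nat.pos_of_ne_zero (NeZero.ne n))
  have hS₁ : ∀ (κ : Fin 4) (u : Site 4), BiLoc ((fun κ u => cK • ghCur κ u) κ u) u u (|cK| * Real.exp (1 / (n : ℝ))) (1 / (n : ℝ)) :=
    fun κ u => biLoc_smul' cK (biLoc_ghCur κ u (1 / (n : ℝ)))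
  have hS₂ : ∀ (κ : Fin 4) (u : Site 4), BiLoc ((fun κ u => cQ • qAntiAt ρ n κ u) κ u) u u
      (|cQ| * (8 / (n : ℝ) ^ 3 * Real.exp (8 * 1))) (1 / (n : ℝ)) :=
    fun κ u => biLoc_smul' cQ (biLoc_qAntiAt n κ u hρ zero_le_one)
  have hT : ∀ (κ : Fin 4) (u : Site 4), BiLoc ((fun μ y => (x₀ * cK) • ghX μ y) κ u) u u (|x₀ * cK| * Real.exp (1 / (n : ℝ))) (1 / (n : ℝ)) :=
    fun κ u => biLoc_smul' (x₀ * cK) (biLoc_ghX κ u (1 / (n : ℝ)))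
  have hW₁ : ∀ (κ : Fin 4) (u : Site 4) (l : Fin 4) (u' : Site 4),
      BiLoc (diagExt (fun μ y => (x₀ * cK) • ghX μ y) κ u l u') u u' (|x₀ * cK| * Real.exp (1 / (n : ℝ))) (1 / (n : ℝ)) :=
    fun κ u l u' => biLoc_diagExt (fun μ y => (x₀ * cK) • ghX μ y) hT (by positivity) κ u l u'
  have hW₂ : ∀ (κ : Fin 4) (u : Site 4) (l : Fin 4) (u' : Site 4),
      BiLoc ((fun κ v l v' => (-(x₀ * cQ * (n : ℝ) ^ 4)) • qSqAt ρ n κ v l v') κ u l u') u u'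
        (|(-(x₀ * cQ * (n : ℝ) ^ 4))| * (8 / (n : ℝ) ^ 3 * Real.exp (8 * 1)) ^ 2) (1 / (n : ℝ)) :=
    fun κ u l u' => biLoc_smul' (-(x₀ * cQ * (n : ℝ) ^ 4)) (biLoc_qSqAt n κ u l u' hρ zero_le_one)
  rw [SghAt_eq_add, WghAt_eq_add]
  exact word_split (spr_Ggh n a ha) hS₁ hS₂ hW₁ hW₂ hn hw hCw hδw μ ν z

end Ghost

end Summit.QuantumFields.BalabanUV.Beta.D1BFx.PackedWordSplit

end
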